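import Mathlib

/-!
# Gauss–Manin trace identity for the Weil-type families `y² = x(x²−a²)·h(x)` in every genus (solo-blind s62)

Generalises `SoloBlindWeilDetFlat` (genus 3, explicit expanded polynomials) to an arbitrary cofactor
`h ∈ K[X]` over any field `K` (characteristic zero for the trace), with honest polynomial algebra
(`Polynomial.divByMonic`, `Polynomial.derivative`).  For `f = X(X²−a²)h` put `g₊ := f/(X−a) = X(X+a)h`,
`g₋ := f/(X+a) = X(X−a)h` (`gP`, `gM`).  For a polynomial `g` and a base point `e`:
* `dq g e = (g − g(e))/(X − e)`, `Rq g e = g′ − dq g e` (so `Rq g e` vanishes at `e`, `Rq_eval_self`, and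
  `(Rq g e)(y) = g′(y) − (g(y) − g(e))/(y − e)` for `y ≠ e`, `Rq_eval_of_ne`);
* `Qq g e α = g(e)·(X^α − e^α)/(X − e) + e^α·Rq g e` satisfies the REDUCTION IDENTITY
  `g(e)·X^α = (X − e)·Qq g e α − e^α·((X − e)·g′ − g)` (`reduction`).  Analytic meaning (not certified
  here): on `y² = f = (x − e)g`, `x^α dx/((x−e)y) = (Qq/g(e))·dx/y − (2e^α/g(e))·d(y/(x−e))`, hence
  `∂_a(x^α dx/y) = ½[x^α/((x−a)y) − x^α/((x+a)y)]dx ≡ Σ_β [X^β](Qq g₊ a α − Qq g₋ (−a) α)/(2g₊(a)) · x^β dx/y`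
  modulo exact forms when `h(−a) = h(a)` (then `g₊(a) = g₋(−a) = 2a²h(a)`);
* `trace_even` / `trace_odd`: for EVERY `h`, `a ≠ 0` and `n` with `deg h + 2 ≤ 2n`,
  `Σ_{m<n} [X^{2m}](Qq g₊ a (2m) − Qq g₋ (−a) (2m)) = −a·(h(a) + h(−a))` and the odd-frame sum is
  `+a·(h(a) + h(−a))`; with `h(−a) = h(a)` these are `∓g₊(a)/a` (`trace_even_symm`, `trace_odd_symm`):
  the Gauss–Manin connection of `y² = x(x²−a²)h(x)` (`deg h = 2g−2`, `n = g`) has trace `−da/(2a)` on the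
  even frame `⟨x^{2m}dx/y⟩_{m<g}` and `+da/(2a)` on the odd one — the input "(T′1)_g" of THEOREM V_∞
  (closed form of the Weil-class period determinants in every genus), `paper/weil-det.md` §10 of the notes;
* `no_mixing`: if `h(−X) = h(X)` then `[X^β](Qq g₊ a α − Qq g₋ (−a) α) = 0` whenever `α + β` is odd.
Proof of the trace identity: `2·trace = R₊(a) + R₊(−a) − R₋(a) − R₋(−a)` with `R₊(a) = R₋(−a) = 0` and
`R₊(−a) = −a(h(a)+h(−a)) = −R₋(a)`.  Bearing on the summit statement: none directly (by-product).
-/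

open Polynomial Finset

namespace Summit.KontsevichZagierPeriods.KontsevichZagierPeriods.Theorems
namespace SoloBlind
namespace WeilTraceGeneral

variable {K : Type*} [Field K]

section quotient
variable (g : K[X]) (e : K)

/-- The exact difference quotient `(g − g(e))/(X − e)`. -/
noncomputable def dq : K[X] := (g - C (g.eval e)) /ₘ (X - C e)

/-- `(X − e)·dq g e = g − g(e)`. -/
theorem X_sub_C_mul_dq : (X - C e) * dq g e = g - C (g.eval e) := by
  unfold dq
  exact mul_divByMonic_eq_iff_isRoot.mpr (by simp [IsRoot])

/-- Off the base point: `(dq g e)(y) = (g(y) − g(e))/(y − e)`. -/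
theorem dq_eval_of_ne {y : K} (hy : y ≠ e) :
    (dq g e).eval y = (g.eval y - g.eval e) / (y - e) := by
  have h := congrArg (eval y) (X_sub_C_mul_dq g e)
  simp only [eval_mul, eval_sub, eval_X, eval_C] at h
  rw [eq_div_iff (sub_ne_zero.mpr hy), mul_comm]
  exact h

/-- At the base point: `(dq g e)(e) = g′(e)`. -/
theorem dq_eval_self : (dq g e).eval e = (derivative g).eval e := by
  have h := congrArg (fun p => eval e (derivative p)) (X_sub_C_mul_dq g e)
  simp only [derivative_mul, derivative_sub, derivative_X, derivative_C, sub_zero, one_mul,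
    eval_add, eval_mul, eval_sub, eval_X, eval_C, sub_self, zero_mul, add_zero] at h
  exact h

/-- `R_e(g) := g′ − (g − g(e))/(X − e)`. -/
noncomputable def Rq : K[X] := derivative g - dq g e

/-- `R_e(g)(e) = 0`. -/
theorem Rq_eval_self : (Rq g e).eval e = 0 := by
  simp [Rq, dq_eval_self]

/-- `R_e(g)(y) = g′(y) − (g(y) − g(e))/(y − e)` for `y ≠ e`. -/
theorem Rq_eval_of_ne {y : K} (hy : y ≠ e) :
    (Rq g e).eval y = (derivative g).eval y - (g.eval y - g.eval e) / (y - e) := by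
  simp [Rq, dq_eval_of_ne g e hy]

/-- `deg R_e(g) ≤ deg g − 1`. -/
theorem natDegree_Rq_le : (Rq g e).natDegree ≤ g.natDegree - 1 := by
  unfold Rq dq
  refine (natDegree_sub_le _ _).trans (max_le (natDegree_derivative_le g) ?_)
  rw [natDegree_divByMonic _ (monic_X_sub_C e), natDegree_X_sub_C]
  refine Nat.sub_le_sub_right ((natDegree_sub_le _ _).trans ?_) 1
  simp

/-- The geometric-sum polynomial `S_{α,e} = Σ_{i<α} X^i e^{α−1−i} = (X^α − e^α)/(X − e)`. -/
noncomputable def geomS (α : ℕ) : K[X] := ∑ i ∈ range α, X ^ i * C e ^ (α - 1 - i)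

/-- `S_{α,e}·(X − e) = X^α − e^α`. -/
theorem geomS_mul (α : ℕ) : geomS e α * (X - C e) = X ^ α - C e ^ α :=
  geom_sum₂_mul X (C e) α

/-- Coefficients of `S_{α,e}`. -/
theorem geomS_coeff (α β : ℕ) : (geomS e α).coeff β = if β < α then e ^ (α - 1 - β) else 0 := by
  unfold geomS
  rw [finsetSum_coeff]
  have hterm : ∀ i ∈ range α, ((X : K[X]) ^ i * C e ^ (α - 1 - i)).coeff β
      = if β = i then e ^ (α - 1 - β) else 0 := by
    intro i _
    rw [← C_pow, mul_comm, coeff_C_mul_X_pow]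
    split_ifs with h1
    · subst h1; rfl
    · rfl
  rw [sum_congr rfl hterm, sum_ite_eq]
  simp only [mem_range]

/-- `[X^α] S_{α,e} = 0`. -/
theorem geomS_coeff_self (α : ℕ) : (geomS e α).coeff α = 0 := by
  rw [geomS_coeff]; simp

/-- `Q_{α,e}(g) := g(e)·S_{α,e} + e^α·R_e(g)`. -/
noncomputable def Qq (α : ℕ) : K[X] := C (g.eval e) * geomS e α + C e ^ α * Rq g e

/-- GAUSS–MANIN REDUCTION IDENTITY: `g(e)·X^α = (X − e)·Q_{α,e}(g) − e^α·((X − e)·g′ − g)`. -/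
theorem reduction (α : ℕ) :
    C (g.eval e) * X ^ α = (X - C e) * Qq g e α - C e ^ α * ((X - C e) * derivative g - g) := by
  have h1 := geomS_mul e α
  have h2 := X_sub_C_mul_dq g e
  unfold Qq Rq
  linear_combination (-C (g.eval e)) * h1 + (C e ^ α) * h2

/-- Diagonal coefficient: `[X^α] Q_{α,e}(g) = e^α·[X^α] R_e(g)`. -/
theorem Qq_coeff_self (α : ℕ) : (Qq g e α).coeff α = e ^ α * (Rq g e).coeff α := by
  unfold Qq
  rw [coeff_add, coeff_C_mul, geomS_coeff_self, mul_zero, zero_add, ← C_pow, coeff_C_mul]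

/-- All coefficients: `[X^β] Q_{α,e}(g) = g(e)·[β<α]·e^{α−1−β} + e^α·[X^β] R_e(g)`. -/
theorem Qq_coeff (α β : ℕ) : (Qq g e α).coeff β
    = g.eval e * (if β < α then e ^ (α - 1 - β) else 0) + e ^ α * (Rq g e).coeff β := by
  unfold Qq
  rw [coeff_add, coeff_C_mul, geomS_coeff, ← C_pow, coeff_C_mul]

end quotient

section negX
variable (g : K[X]) (e : K)

/-- `[Xⁿ] p(−X) = (−1)ⁿ [Xⁿ] p`. [folklore] -/
theorem coeff_comp_neg_X (p : K[X]) (n : ℕ) : (p.comp (-X)).coeff n = (-1) ^ n * p.coeff n := by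
  rw [comp_eq_sum_left, sum_def, finsetSum_coeff]
  have h : ∀ k ∈ p.support, (C (p.coeff k) * (-X : K[X]) ^ k).coeff n =
      if n = k then (-1) ^ n * p.coeff n else 0 := by
    intro k _
    have hC : ((-X : K[X]) ^ k) = C ((-1 : K) ^ k) * X ^ k := by
      rw [neg_pow, map_pow, map_neg, map_one]
    rw [hC, ← mul_assoc, ← C_mul, coeff_C_mul_X_pow]
    split_ifs with hnk
    · subst hnk; ring
    · rfl
  rw [Finset.sum_congr rfl h, Finset.sum_ite_eq]
  split_ifs with hn
  · rfl
  · rw [notMem_support_iff.mp hn, mul_zero]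

/-- `g(−X)` evaluated at `−e` is `g(e)`. -/
theorem eval_comp_neg_X : (g.comp (-X)).eval (-e) = g.eval e := by
  simp [eval_comp]

/-- `dq (g(−X)) (−e) = −(dq g e)(−X)`. -/
theorem dq_comp_neg_X : dq (g.comp (-X)) (-e) = -(dq g e).comp (-X) := by
  have key : (X - C (-e)) * (-(dq g e).comp (-X)) = g.comp (-X) - C ((g.comp (-X)).eval (-e)) := by
    have h0 := congrArg (fun p => p.comp (-X)) (X_sub_C_mul_dq g e)
    simp only [mul_comp, sub_comp, X_comp, C_comp] at h0
    rw [eval_comp_neg_X, map_neg]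
    linear_combination h0
  show (g.comp (-X) - C ((g.comp (-X)).eval (-e))) /ₘ (X - C (-e)) = _
  rw [← key]
  exact mul_divByMonic_cancel_left _ (monic_X_sub_C _)

/-- `R_{−e}(g(−X)) = −R_e(g)(−X)`. -/
theorem Rq_comp_neg_X : Rq (g.comp (-X)) (-e) = -(Rq g e).comp (-X) := by
  unfold Rq
  rw [dq_comp_neg_X, derivative_comp, derivative_neg, derivative_X, sub_comp]
  ring

end negX

section parity
variable (y : K)

/-- `Σ_{i<2n} c_i y^i + Σ_{i<2n} c_i (−y)^i = 2 Σ_{m<n} y^{2m} c_{2m}`. -/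
theorem sum_add_sum_neg (c : ℕ → K) (n : ℕ) :
    ∑ i ∈ range (2 * n), c i * y ^ i + ∑ i ∈ range (2 * n), c i * (-y) ^ i
      = 2 * ∑ m ∈ range n, y ^ (2 * m) * c (2 * m) := by
  induction n with
  | zero => simp
  | succ n ih =>
    have h1 : (-y) ^ (2 * n) = y ^ (2 * n) := (even_two_mul n).neg_pow y
    have h2 : (-y) ^ (2 * n + 1) = -y ^ (2 * n + 1) := (odd_two_mul_add_one n).neg_pow y
    rw [show 2 * (n + 1) = 2 * n + 1 + 1 from by ring, sum_range_succ, sum_range_succ,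
      sum_range_succ (fun i => c i * (-y) ^ i), sum_range_succ (fun i => c i * (-y) ^ i),
      sum_range_succ (fun m => y ^ (2 * m) * c (2 * m)), h1, h2]
    linear_combination ih

/-- `Σ_{i<2n} c_i y^i − Σ_{i<2n} c_i (−y)^i = 2 Σ_{m<n} y^{2m+1} c_{2m+1}`. -/
theorem sum_sub_sum_neg (c : ℕ → K) (n : ℕ) :
    ∑ i ∈ range (2 * n), c i * y ^ i - ∑ i ∈ range (2 * n), c i * (-y) ^ i
      = 2 * ∑ m ∈ range n, y ^ (2 * m + 1) * c (2 * m + 1) := by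
  induction n with
  | zero => simp
  | succ n ih =>
    have h1 : (-y) ^ (2 * n) = y ^ (2 * n) := (even_two_mul n).neg_pow y
    have h2 : (-y) ^ (2 * n + 1) = -y ^ (2 * n + 1) := (odd_two_mul_add_one n).neg_pow y
    rw [show 2 * (n + 1) = 2 * n + 1 + 1 from by ring, sum_range_succ, sum_range_succ,
      sum_range_succ (fun i => c i * (-y) ^ i), sum_range_succ (fun i => c i * (-y) ^ i),
      sum_range_succ (fun m => y ^ (2 * m + 1) * c (2 * m + 1)), h1, h2]
    linear_combination ih

variable (p : K[X])

/-- Even part evaluated: `2 Σ_{m<n} y^{2m}[X^{2m}]p = p(y) + p(−y)` for `deg p < 2n`. -/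
theorem two_mul_sum_even {n : ℕ} (hn : p.natDegree < 2 * n) :
    2 * ∑ m ∈ range n, y ^ (2 * m) * p.coeff (2 * m) = p.eval y + p.eval (-y) := by
  rw [eval_eq_sum_range' hn, eval_eq_sum_range' hn, sum_add_sum_neg]

/-- Odd part evaluated: `2 Σ_{m<n} y^{2m+1}[X^{2m+1}]p = p(y) − p(−y)` for `deg p < 2n`. -/
theorem two_mul_sum_odd {n : ℕ} (hn : p.natDegree < 2 * n) :
    2 * ∑ m ∈ range n, y ^ (2 * m + 1) * p.coeff (2 * m + 1) = p.eval y - p.eval (-y) := by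
  rw [eval_eq_sum_range' hn, eval_eq_sum_range' hn, sum_sub_sum_neg]

end parity

section family
variable (h : K[X]) (a : K)

/-- `g₊ := f/(X − a) = X(X + a)h` for `f = X(X² − a²)h`. -/
noncomputable def gP : K[X] := X * (X + C a) * h

/-- `g₋ := f/(X + a) = X(X − a)h`. -/
noncomputable def gM : K[X] := X * (X - C a) * h

/-- `(X − a)·g₊ = f`. -/
theorem X_sub_C_mul_gP : (X - C a) * gP h a = X * (X ^ 2 - C a ^ 2) * h := by unfold gP; ring

/-- `(X + a)·g₋ = f`. -/
theorem X_add_C_mul_gM : (X + C a) * gM h a = X * (X ^ 2 - C a ^ 2) * h := by unfold gM; ring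

/-- `g₊(a) = 2a²h(a)`. -/
theorem gP_eval_pos : (gP h a).eval a = 2 * a ^ 2 * h.eval a := by
  simp only [gP, eval_mul, eval_add, eval_X, eval_C]; ring

/-- `g₊(−a) = 0`. -/
theorem gP_eval_neg : (gP h a).eval (-a) = 0 := by
  simp only [gP, eval_mul, eval_add, eval_X, eval_C, neg_add_cancel, mul_zero, zero_mul]

/-- `g₋(−a) = 2a²h(−a)`. -/
theorem gM_eval_neg : (gM h a).eval (-a) = 2 * a ^ 2 * h.eval (-a) := by
  simp only [gM, eval_mul, eval_sub, eval_X, eval_C]; ring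

/-- `g₋(a) = 0`. -/
theorem gM_eval_pos : (gM h a).eval a = 0 := by
  simp only [gM, eval_mul, eval_sub, eval_X, eval_C, sub_self, mul_zero, zero_mul]

/-- `g₊′(−a) = −a·h(−a)`. -/
theorem derivative_gP_eval_neg : (derivative (gP h a)).eval (-a) = -a * h.eval (-a) := by
  have hd : derivative (gP h a) = (X + C a) * h + X * h + X * (X + C a) * derivative h := by
    simp only [gP, derivative_mul, derivative_X, derivative_add, derivative_C]; ring
  rw [hd]; simp only [eval_add, eval_mul, eval_X, eval_C]; ring

/-- `g₋′(a) = a·h(a)`. -/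
theorem derivative_gM_eval_pos : (derivative (gM h a)).eval a = a * h.eval a := by
  have hd : derivative (gM h a) = (X - C a) * h + X * h + X * (X - C a) * derivative h := by
    simp only [gM, derivative_mul, derivative_X, derivative_sub, derivative_C]; ring
  rw [hd]; simp only [eval_add, eval_mul, eval_sub, eval_X, eval_C]; ring

/-- `deg g₊ ≤ deg h + 2`. -/
theorem natDegree_gP_le : (gP h a).natDegree ≤ h.natDegree + 2 := by
  unfold gP
  have h2 : (X * (X + C a) : K[X]).natDegree ≤ 2 := by compute_degree!
  exact natDegree_mul_le.trans (by omega)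

/-- `deg g₋ ≤ deg h + 2`. -/
theorem natDegree_gM_le : (gM h a).natDegree ≤ h.natDegree + 2 := by
  unfold gM
  have h2 : (X * (X - C a) : K[X]).natDegree ≤ 2 := by compute_degree!
  exact natDegree_mul_le.trans (by omega)

/-- `g₋ = g₊(−X)` when `h(−X) = h(X)`. -/
theorem gM_eq_gP_comp_neg_X (hh : h.comp (-X) = h) : gM h a = (gP h a).comp (-X) := by
  unfold gM gP
  rw [mul_comp, mul_comp, hh, add_comp, X_comp, C_comp]
  ring

/-- NO MIXING (every genus): if `h(−X) = h(X)` then `[X^β](Q_{α,a}(g₊) − Q_{α,−a}(g₋)) = 0` whenever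
`α + β` is odd — the even frame `⟨x^{2m}dx/y⟩` and the odd frame are not coupled by `∂_a`. -/
theorem no_mixing (hh : h.comp (-X) = h) (α β : ℕ) (hodd : Odd (α + β)) :
    (Qq (gP h a) a α - Qq (gM h a) (-a) α).coeff β = 0 := by
  have hsym : h.eval (-a) = h.eval a := by
    have := congrArg (eval a) hh
    simp only [eval_comp, eval_neg, eval_X] at this
    exact this
  have hR : Rq (gM h a) (-a) = -(Rq (gP h a) a).comp (-X) := by
    rw [gM_eq_gP_comp_neg_X h a hh, Rq_comp_neg_X]
  rw [coeff_sub, Qq_coeff, Qq_coeff, hR, coeff_neg, coeff_comp_neg_X, gP_eval_pos, gM_eval_neg, hsym]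
  obtain ⟨k, hk⟩ := hodd
  have hpow : ((-1 : K)) ^ α * (-1) ^ β = -1 := by
    rw [← pow_add, hk, pow_succ, (even_two_mul k).neg_one_pow]; ring
  split_ifs with hlt
  · have hev : Even (α - 1 - β) := ⟨k - β, by omega⟩
    rw [hev.neg_pow, neg_pow a α]
    linear_combination (a ^ α * (Rq (gP h a) a).coeff β) * hpow
  · rw [neg_pow a α]
    linear_combination (a ^ α * (Rq (gP h a) a).coeff β) * hpow

variable [CharZero K]

/-- `−a ≠ a` for `a ≠ 0` in characteristic zero. -/
theorem neg_ne_of_ne_zero (ha : a ≠ 0) : -a ≠ a := fun h' => ha (CharZero.neg_eq_self_iff.mp h')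

/-- `R₊(−a) = −a·(h(a) + h(−a))`, `R₊ := Rq g₊ a`. -/
theorem Rq_gP_eval_neg (ha : a ≠ 0) :
    (Rq (gP h a) a).eval (-a) = -(a * (h.eval a + h.eval (-a))) := by
  rw [Rq_eval_of_ne _ _ (neg_ne_of_ne_zero a ha), derivative_gP_eval_neg, gP_eval_neg, gP_eval_pos]
  have h2a : (-a - a : K) ≠ 0 := by
    have := neg_ne_of_ne_zero a ha; rwa [Ne, ← sub_eq_zero] at this
  field_simp; ring

/-- `R₋(a) = a·(h(a) + h(−a))`, `R₋ := Rq g₋ (−a)`. -/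
theorem Rq_gM_eval_pos (ha : a ≠ 0) :
    (Rq (gM h a) (-a)).eval a = a * (h.eval a + h.eval (-a)) := by
  rw [Rq_eval_of_ne _ _ (neg_ne_of_ne_zero a ha).symm, derivative_gM_eval_pos, gM_eval_pos, gM_eval_neg]
  have h2a : (a - -a : K) ≠ 0 := by
    have := (neg_ne_of_ne_zero a ha).symm; rwa [Ne, ← sub_eq_zero] at this
  field_simp; ring

/-- TRACE IDENTITY, even frame, every genus: for any `h`, `a ≠ 0`, `deg h + 2 ≤ 2n`,
`Σ_{m<n} [X^{2m}](Q_{2m,a}(g₊) − Q_{2m,−a}(g₋)) = −a·(h(a) + h(−a))`. -/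
theorem trace_even (ha : a ≠ 0) {n : ℕ} (hn : h.natDegree + 2 ≤ 2 * n) :
    ∑ m ∈ range n, (Qq (gP h a) a (2 * m) - Qq (gM h a) (-a) (2 * m)).coeff (2 * m)
      = -(a * (h.eval a + h.eval (-a))) := by
  have hd1 : (Rq (gP h a) a).natDegree < 2 * n :=
    lt_of_le_of_lt (natDegree_Rq_le _ _) (by have := natDegree_gP_le h a; omega)
  have hd2 : (Rq (gM h a) (-a)).natDegree < 2 * n :=
    lt_of_le_of_lt (natDegree_Rq_le _ _) (by have := natDegree_gM_le h a; omega)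
  simp only [coeff_sub, Qq_coeff_self, sum_sub_distrib]
  have e1 := two_mul_sum_even a (Rq (gP h a) a) hd1
  have e2 := two_mul_sum_even (-a) (Rq (gM h a) (-a)) hd2
  rw [Rq_eval_self, Rq_gP_eval_neg h a ha] at e1
  rw [neg_neg, Rq_eval_self, Rq_gM_eval_pos h a ha] at e2
  apply mul_left_cancel₀ (two_ne_zero : (2 : K) ≠ 0)
  rw [mul_sub, e1, e2]
  ring

/-- TRACE IDENTITY, odd frame, every genus: for any `h`, `a ≠ 0`, `deg h + 2 ≤ 2n`,
`Σ_{m<n} [X^{2m+1}](Q_{2m+1,a}(g₊) − Q_{2m+1,−a}(g₋)) = +a·(h(a) + h(−a))`. -/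
theorem trace_odd (ha : a ≠ 0) {n : ℕ} (hn : h.natDegree + 2 ≤ 2 * n) :
    ∑ m ∈ range n, (Qq (gP h a) a (2 * m + 1) - Qq (gM h a) (-a) (2 * m + 1)).coeff (2 * m + 1)
      = a * (h.eval a + h.eval (-a)) := by
  have hd1 : (Rq (gP h a) a).natDegree < 2 * n :=
    lt_of_le_of_lt (natDegree_Rq_le _ _) (by have := natDegree_gP_le h a; omega)
  have hd2 : (Rq (gM h a) (-a)).natDegree < 2 * n :=
    lt_of_le_of_lt (natDegree_Rq_le _ _) (by have := natDegree_gM_le h a; omega)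
  simp only [coeff_sub, Qq_coeff_self, sum_sub_distrib]
  have e1 := two_mul_sum_odd a (Rq (gP h a) a) hd1
  have e2 := two_mul_sum_odd (-a) (Rq (gM h a) (-a)) hd2
  rw [Rq_eval_self, Rq_gP_eval_neg h a ha] at e1
  rw [neg_neg, Rq_eval_self, Rq_gM_eval_pos h a ha] at e2
  apply mul_left_cancel₀ (two_ne_zero : (2 : K) ≠ 0)
  rw [mul_sub, e1, e2]
  ring

/-- The total trace vanishes (for any `h`). -/
theorem trace_total (ha : a ≠ 0) {n : ℕ} (hn : h.natDegree + 2 ≤ 2 * n) :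
    ∑ m ∈ range n, (Qq (gP h a) a (2 * m) - Qq (gM h a) (-a) (2 * m)).coeff (2 * m)
      + ∑ m ∈ range n, (Qq (gP h a) a (2 * m + 1) - Qq (gM h a) (-a) (2 * m + 1)).coeff (2 * m + 1)
      = 0 := by
  rw [trace_even h a ha hn, trace_odd h a ha hn]; ring

/-- Symmetric case `h(−a) = h(a)` (then `g₊(a) = g₋(−a) =: d = 2a²h(a)`): even trace `= −d/a`,
stated as `a·trace = −d`. -/
theorem trace_even_symm (ha : a ≠ 0) (hsym : h.eval (-a) = h.eval a) {n : ℕ}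
    (hn : h.natDegree + 2 ≤ 2 * n) :
    a * ∑ m ∈ range n, (Qq (gP h a) a (2 * m) - Qq (gM h a) (-a) (2 * m)).coeff (2 * m)
      = -(gP h a).eval a := by
  rw [trace_even h a ha hn, gP_eval_pos, hsym]; ring

/-- Symmetric case: odd trace `= +d/a`, stated as `a·trace = d`. -/
theorem trace_odd_symm (ha : a ≠ 0) (hsym : h.eval (-a) = h.eval a) {n : ℕ}
    (hn : h.natDegree + 2 ≤ 2 * n) :
    a * ∑ m ∈ range n, (Qq (gP h a) a (2 * m + 1) - Qq (gM h a) (-a) (2 * m + 1)).coeff (2 * m + 1)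
      = (gP h a).eval a := by
  rw [trace_odd h a ha hn, gP_eval_pos, hsym]; ring

/-- Genus-3 cross-check against `SoloBlindWeilDetFlat.trace_even` (`h = (X²−b²)(X²−c²)`, `n = 3`):
the even trace is `−2a(a²−b²)(a²−c²) = −dd/a`. -/
theorem trace_even_genus3 (a b c : K) (ha : a ≠ 0) :
    ∑ m ∈ range 3, (Qq (gP ((X ^ 2 - C b ^ 2) * (X ^ 2 - C c ^ 2)) a) a (2 * m)
        - Qq (gM ((X ^ 2 - C b ^ 2) * (X ^ 2 - C c ^ 2)) a) (-a) (2 * m)).coeff (2 * m)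
      = -(2 * a * (a ^ 2 - b ^ 2) * (a ^ 2 - c ^ 2)) := by
  have hdeg : ((X ^ 2 - C b ^ 2) * (X ^ 2 - C c ^ 2) : K[X]).natDegree + 2 ≤ 2 * 3 := by
    have : ((X ^ 2 - C b ^ 2) * (X ^ 2 - C c ^ 2) : K[X]).natDegree ≤ 4 := by compute_degree!
    omega
  rw [trace_even _ a ha hdeg]
  simp only [eval_mul, eval_sub, eval_pow, eval_X, eval_C]
  ring

end family

end WeilTraceGeneral
end SoloBlind
end Summit.KontsevichZagierPeriods.KontsevichZagierPeriods.Theorems
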